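import Literature.NumberTheory.Sieve.RoughNumbersCoprimeProgressions
import Literature.NumberTheory.Sieve.CoprimeSquarefreeSums
import Mathlib.NumberTheory.Harmonic.EulerMascheroni
import HarnessLib

/-!
# Bombieri–Friedlander–Iwaniec 1986, Theorem 7* (§14): windows of `∑ 1/φ(rn)` over `(n, k) = 1`

Topic `Literature/NumberTheory/Sieve`.  Everything here is PROVED; no named fact is introduced.

In the `q ↔ s` switch for `Δ*` (BFI §13 p. 241–242, §14 p. 246) the "expected" main terms of the
switched and the unswitched arrangements are both sums of the SAME function
`f(n) = [(n, k) = 1]/φ(rn)` over windows `(U, V]` of ratio `V/U ≈ 2` — at the scale of `q` for the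
unswitched sum and at the scale of `s` for the switched one ("since both `q` and `s` are counted with
weight 1 … `s ∼ S = x/QR > ℒ^B`, this lower bound being crucial to the argument").  This file proves
that such windows depend on the scale only through an error `O_k(polylog/U)`:

* `abs_sum_Ioc_inv_sub_log_le` — `|∑_{U<n≤V} 1/n − log(V/U)| ≤ 2/U` (from Mathlib's envelopes of
  Euler's constant);
* `copWin`, `abs_copWin_sub_le` — `|∑_{U<m≤V,(m,k)=1} 1/m − (φ(k)/k) log(V/U)| ≤ 10 τ(k)/U`
  (`1 ≤ U ≤ V ≤ 4U`), by Möbius inversion of the coprimality;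
* `inv_totient_mul_eq` — `1/φ(rn) = (1/(φ(r) n)) ∑_{e∣n, e squarefree, (e,r)=1} 1/φ(e)`
  (both sides are multiplicative in `n`; checked on prime powers);
* `phiWin`, `phiWin_eq_sum` (hyperbola decomposition), `abs_phiWin_sub_le`
  (`|W(U,V) − (φ(k)/k) log(V/U) Σ₁(V)/φ(r)| ≤ 22 τ(k) Φ(V)/(φ(r) U)` for `1 ≤ U ≤ V ≤ 3U`, with
  `Φ(V) = ∑_{e ≤ V} 1/φ(e)` = `totInvSum`, `Σ₁` = `sig1`), `phiWin_le` (`W ≤ Φ(V)/φ(r)`) and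
  `abs_phiWin_sub_phiWin_le`: two windows of ratio `≤ 3` differ by at most
  `(Φ/φ(r)) (|log(V/U) − log(V'/U')| + 24 τ(k)(1/U + 1/U'))`.  (`Φ(V) ≪ (log V)^4` is the tree's
  `exists_sum_sigma_zero_pow_div_totient_le_real 0`.)

## References

* E. Bombieri, J. B. Friedlander, H. Iwaniec, *Primes in arithmetic progressions to large moduli*,
  Acta Math. 156 (1986), 203–251, §13 p. 241–242. [BombieriFriedlanderIwaniecActa1986]
-/

noncomputable section

open Finset Real

open scoped ArithmeticFunction.sigma ArithmeticFunction.Moebius ArithmeticFunction.zeta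
  ArithmeticFunction

namespace Literature.NumberTheory.Sieve

namespace BFI

/-! ### Harmonic windows -/

/-- `|H(k) − (log k + γ)| ≤ 1/k` for `k ≥ 1` (Mathlib's envelopes `H(k) − log(k+1) < γ < H(k) − log k`).
This is the statement of the tree's `DirichletAbel.abs_harmonic_sub_log_sub_eulerMascheroni_le`
(`Literature/NumberTheory/LFunctions/DirichletConvOneChiSum.lean`); restated here to keep the import
closure of the BFI cone small (that file imports the `L(1,χ)` machinery). [folklore] -/
theorem abs_harmonic_sub_log_sub_euler_le {k : ℕ} (hk : 1 ≤ k) :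
    |(harmonic k : ℝ) - (Real.log k + Real.eulerMascheroniConstant)| ≤ 1 / (k : ℝ) := by
  have hk0 : (0 : ℝ) < k := by exact_mod_cast hk
  have h1 := Real.eulerMascheroniConstant_lt_eulerMascheroniSeq' k
  rw [Real.eulerMascheroniSeq', if_neg (by omega)] at h1
  have h2 := Real.eulerMascheroniSeq_lt_eulerMascheroniConstant k
  rw [Real.eulerMascheroniSeq] at h2
  have hlog : Real.log ((k : ℝ) + 1) - Real.log k ≤ 1 / (k : ℝ) := by
    rw [← Real.log_div (by positivity) hk0.ne']
    have := Real.log_le_sub_one_of_pos (x := ((k : ℝ) + 1) / k) (by positivity)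
    rw [div_sub_one hk0.ne', add_sub_cancel_left] at this
    exact this
  rw [abs_le]
  constructor <;> linarith

/-- The harmonic numbers as real `Icc`-sums. [folklore] -/
theorem harmonic_eq_sum_Icc_real (n : ℕ) : (harmonic n : ℝ) = ∑ i ∈ Icc 1 n, (1 : ℝ) / i := by
  rw [harmonic_eq_sum_Icc]
  push_cast
  exact Finset.sum_congr rfl fun i _ => by rw [one_div]

/-- **`|∑_{U<n≤V} 1/n − log(V/U)| ≤ 2/U`** for `1 ≤ U ≤ V`.  The statement of the tree's
`RhoLogSums.abs_sum_Ioc_inv_sub_log_le` (`QuadraticRootCountLogSums.lean`, whose import closure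
contains Siegel's theorem); restated here for the same reason. [folklore] -/
theorem abs_sum_Ioc_inv_sub_log_le {U V : ℕ} (hU : 1 ≤ U) (hUV : U ≤ V) :
    |∑ n ∈ Ioc U V, (1 : ℝ) / n - Real.log ((V : ℝ) / U)| ≤ 2 / U := by
  have hV : 1 ≤ V := hU.trans hUV
  have hU0 : (0 : ℝ) < U := by exact_mod_cast hU
  have hV0 : (0 : ℝ) < V := by exact_mod_cast hV
  have hIcc : ∀ n : ℕ, Finset.Icc 1 n = Finset.Ioc 0 n := fun n => by
    ext i; simp only [Finset.mem_Icc, Finset.mem_Ioc]; omega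
  have hsum : ∑ n ∈ Ioc U V, (1 : ℝ) / n = (harmonic V : ℝ) - (harmonic U : ℝ) := by
    rw [harmonic_eq_sum_Icc_real, harmonic_eq_sum_Icc_real, hIcc V, hIcc U,
      ← Finset.sum_Ioc_consecutive (fun n : ℕ => (1 : ℝ) / n) (Nat.zero_le U) hUV]
    ring
  rw [hsum, Real.log_div hV0.ne' hU0.ne']
  have h1 := abs_harmonic_sub_log_sub_euler_le hV
  have h2 := abs_harmonic_sub_log_sub_euler_le hU
  have hVU : 1 / (V : ℝ) ≤ 1 / U := one_div_le_one_div_of_le hU0 (by exact_mod_cast hUV)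
  have e2 : (2 : ℝ) / U = 1 / U + 1 / U := by ring
  rw [abs_le] at h1 h2 ⊢
  constructor <;> linarith [h1.1, h1.2, h2.1, h2.2]

/-! ### The coprime harmonic window -/

/-- `∑_{U < m ≤ V, (m, k) = 1} 1/m`. [folklore] -/
def copWin (k U V : ℕ) : ℝ := ∑ m ∈ (Ioc U V).filter (fun m : ℕ => m.Coprime k), (1 : ℝ) / m

/-- `copWin ≥ 0`. [folklore] -/
theorem copWin_nonneg (k U V : ℕ) : 0 ≤ copWin k U V :=
  Finset.sum_nonneg fun _ _ => by positivity

/-- The multiples of `c ≥ 1` in `(U, V]` are `c · (U/c, V/c]`. [folklore] -/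
theorem filter_dvd_Ioc_eq_image {c : ℕ} (hc : 0 < c) (U V : ℕ) :
    (Ioc U V).filter (fun m : ℕ => c ∣ m) = (Ioc (U / c) (V / c)).image (fun m' => c * m') := by
  ext m
  simp only [Finset.mem_filter, Finset.mem_Ioc, Finset.mem_image]
  constructor
  · rintro ⟨⟨h1, h2⟩, m', rfl⟩
    refine ⟨m', ⟨?_, ?_⟩, rfl⟩
    · rw [Nat.div_lt_iff_lt_mul hc, mul_comm]; exact h1
    · rw [Nat.le_div_iff_mul_le hc, mul_comm]; exact h2
  · rintro ⟨m', ⟨h1, h2⟩, rfl⟩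
    refine ⟨⟨?_, ?_⟩, dvd_mul_right c m'⟩
    · rw [Nat.div_lt_iff_lt_mul hc, mul_comm] at h1; exact h1
    · rw [Nat.le_div_iff_mul_le hc, mul_comm] at h2; exact h2

/-- **Möbius inversion of the window**: `∑_{U<m≤V,(m,k)=1} 1/m = ∑_{c∣k} (μ(c)/c) ∑_{U/c < m' ≤ V/c} 1/m'`.
[folklore] -/
theorem copWin_eq_sum_moebius {k : ℕ} (hk : k ≠ 0) (U V : ℕ) :
    copWin k U V = ∑ c ∈ k.divisors, (μ c : ℝ) / c * ∑ m ∈ Ioc (U / c) (V / c), (1 : ℝ) / m := by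
  unfold copWin
  rw [Finset.sum_filter]
  have step1 : ∀ m ∈ Ioc U V, (if m.Coprime k then (1 : ℝ) / m else 0) =
      ∑ c ∈ k.divisors, (μ c : ℝ) * ((if c ∣ m then (1 : ℝ) else 0) * (1 / m)) := by
    intro m hm
    have hm0 : m ≠ 0 := by rw [Finset.mem_Ioc] at hm; omega
    have hind := coprime_indicator_eq_sum_moebius hm0 hk
    rw [Finset.sum_filter] at hind
    have : (if m.Coprime k then (1 : ℝ) / m else 0) = (if m.Coprime k then (1 : ℝ) else 0) * (1 / m) := by
      split_ifs <;> simp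
    rw [this, hind, Finset.sum_mul]
    refine Finset.sum_congr rfl fun c _ => ?_
    split_ifs <;> simp
  rw [Finset.sum_congr rfl step1, Finset.sum_comm]
  refine Finset.sum_congr rfl fun c hc => ?_
  have hc0 : 0 < c := Nat.pos_of_mem_divisors hc
  have hc' : (c : ℝ) ≠ 0 := by exact_mod_cast hc0.ne'
  rw [← Finset.mul_sum]
  have : ∑ m ∈ Ioc U V, (if c ∣ m then (1 : ℝ) else 0) * (1 / m) =
      ∑ m ∈ (Ioc U V).filter (fun m : ℕ => c ∣ m), (1 : ℝ) / m := by
    rw [Finset.sum_filter]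
    exact Finset.sum_congr rfl fun m _ => by split_ifs <;> simp
  rw [this, filter_dvd_Ioc_eq_image hc0, Finset.sum_image (fun x _ y _ h => Nat.eq_of_mul_eq_mul_left hc0 h)]
  have hs : ∑ x ∈ Ioc (U / c) (V / c), (1 : ℝ) / ((c * x : ℕ) : ℝ) =
      1 / c * ∑ x ∈ Ioc (U / c) (V / c), (1 : ℝ) / x := by
    rw [Finset.mul_sum]
    refine Finset.sum_congr rfl fun x _ => ?_
    rw [Nat.cast_mul]
    rcases Nat.eq_zero_or_pos x with h | h
    · subst h; simp
    · have hx : (x : ℝ) ≠ 0 := by exact_mod_cast h.ne'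
      field_simp
  rw [hs]
  ring

/-- `∑_{U < m ≤ V} 1/m ≤ 1 + log V` for `V ≥ 1`. [folklore] -/
theorem sum_Ioc_inv_le_one_add_log (U V : ℕ) :
    ∑ m ∈ Ioc U V, (1 : ℝ) / m ≤ 1 + Real.log V := by
  calc ∑ m ∈ Ioc U V, (1 : ℝ) / m ≤ ∑ m ∈ Ioc 0 V, (1 : ℝ) / m := by
        refine Finset.sum_le_sum_of_subset_of_nonneg (fun m hm => ?_) (fun _ _ _ => by positivity)
        rw [Finset.mem_Ioc] at hm ⊢; omega
    _ = (harmonic V : ℝ) := by rw [harmonic_eq_sum_Icc_real]; rfl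
    _ ≤ 1 + Real.log V := harmonic_le_one_add_log V

/-- `log 7 < 2`. [folklore] -/
theorem log_seven_lt_two : Real.log 7 < 2 := by
  rw [Real.log_lt_iff_lt_exp (by norm_num)]
  have h := Real.exp_one_gt_d9
  have : Real.exp 2 = Real.exp 1 * Real.exp 1 := by rw [← Real.exp_add]; norm_num
  rw [this]; nlinarith


/-- **Floors inside a logarithm**: for `c ≥ 1` and `2c ≤ U ≤ V`,
`|log(⌊V/c⌋/⌊U/c⌋) − log(V/U)| ≤ 2c/U` and `1/⌊U/c⌋ ≤ 2c/U`. [folklore] -/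
theorem abs_log_div_floor_sub_le {c U V : ℕ} (hc0 : 0 < c) (h2c : 2 * c ≤ U) (hUV : U ≤ V) :
    |Real.log (((V / c : ℕ) : ℝ) / ((U / c : ℕ) : ℝ)) - Real.log ((V : ℝ) / U)| ≤ 2 * c / U ∧
      1 / ((U / c : ℕ) : ℝ) ≤ 2 * c / U := by
  set U' := U / c with hU'
  set V' := V / c with hV'
  have hU : 1 ≤ U := le_trans (by omega) h2c
  have hU0 : (0 : ℝ) < U := by exact_mod_cast hU
  have hV0 : (0 : ℝ) < V := by exact_mod_cast (hU.trans hUV)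
  have hc0' : (0 : ℝ) < c := by exact_mod_cast hc0
  have hU'2 : 2 ≤ U' := by rw [hU', Nat.le_div_iff_mul_le hc0]; exact h2c
  have hU'1 : 1 ≤ U' := by omega
  have hU'V' : U' ≤ V' := Nat.div_le_div_right hUV
  have hU'0 : (0 : ℝ) < U' := by exact_mod_cast hU'1
  have hV'0 : (0 : ℝ) < V' := by exact_mod_cast (hU'1.trans hU'V')
  -- floors: `c U' ≤ U < c (U'+1)`, `c V' ≤ V < c (V'+1)`
  have hUl : (c : ℝ) * U' ≤ U := by
    have := Nat.div_mul_le_self U c; rw [mul_comm] at this; exact_mod_cast this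
  have hUu : (U : ℝ) < c * (U' + 1) := by
    have := Nat.lt_div_mul_add (a := U) hc0
    have e : U / c * c + c = c * (U / c + 1) := by ring
    rw [e] at this; exact_mod_cast this
  have hVl : (c : ℝ) * V' ≤ V := by
    have := Nat.div_mul_le_self V c; rw [mul_comm] at this; exact_mod_cast this
  have hVu : (V : ℝ) < c * (V' + 1) := by
    have := Nat.lt_div_mul_add (a := V) hc0
    have e : V / c * c + c = c * (V / c + 1) := by ring
    rw [e] at this; exact_mod_cast this
  -- `U' ≥ U/(2c)`, so `1/U' ≤ 2c/U`
  have hinvU' : 1 / (U' : ℝ) ≤ 2 * c / U := by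
    have h2U' : (2 : ℝ) ≤ U' := by exact_mod_cast hU'2
    rw [div_le_div_iff₀ hU'0 hU0]; nlinarith
  refine ⟨?_, hinvU'⟩
  -- `log(V'/U') − log(V/U) = log P`, `P = (cV'/V) · (U/(cU'))`
  set P : ℝ := ((c : ℝ) * V' / V) * (U / (c * U')) with hP
  have hPpos : 0 < P := by positivity
  have hlogeq : Real.log ((V' : ℝ) / U') - Real.log ((V : ℝ) / U) = Real.log P := by
    rw [hP, Real.log_mul (by positivity) (by positivity), Real.log_div (by positivity) hV0.ne',
      Real.log_div hU0.ne' (by positivity), Real.log_mul hc0'.ne' hV'0.ne',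
      Real.log_mul hc0'.ne' hU'0.ne', Real.log_div hV'0.ne' hU'0.ne', Real.log_div hV0.ne' hU0.ne']
    ring
  have hup : Real.log P ≤ 1 / U' := by
    have h1 : (c : ℝ) * V' / V ≤ 1 := by rw [div_le_one hV0]; exact hVl
    have h2 : (U : ℝ) / (c * U') ≤ 1 + 1 / U' := by
      rw [div_le_iff₀ (by positivity)]
      have : (1 + 1 / (U' : ℝ)) * (c * U') = c * (U' + 1) := by field_simp
      rw [this]; exact hUu.le
    calc Real.log P ≤ P - 1 := Real.log_le_sub_one_of_pos hPpos
      _ ≤ 1 * (1 + 1 / U') - 1 := by rw [hP]; gcongr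
      _ = 1 / U' := by ring
  have hlow : -(2 * c / U) ≤ Real.log P := by
    set t : ℝ := (c : ℝ) / V with ht
    have htU : t ≤ (c : ℝ) / U := div_le_div_of_nonneg_left hc0'.le hU0 (by exact_mod_cast hUV)
    have hcU2 : (c : ℝ) / U ≤ 1 / 2 := by
      rw [div_le_div_iff₀ hU0 (by norm_num)]
      have : (2 : ℝ) * c ≤ U := by exact_mod_cast h2c
      linarith
    have ht0 : 0 ≤ t := by positivity
    have ht2 : t ≤ 1 / 2 := htU.trans hcU2
    have h1 : 1 - t ≤ (c : ℝ) * V' / V := by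
      rw [ht, sub_le_iff_le_add, ← add_div, le_div_iff₀ hV0, one_mul]
      have e : (c : ℝ) * (V' + 1) = c * V' + c := by ring
      linarith [hVu]
    have h2 : (1 : ℝ) ≤ U / (c * U') := by rw [one_le_div (by positivity)]; exact hUl
    have hP1 : 1 - t ≤ P := by
      calc 1 - t = (1 - t) * 1 := (mul_one _).symm
        _ ≤ (c : ℝ) * V' / V * (U / (c * U')) := mul_le_mul h1 h2 zero_le_one (by positivity)
    have hpos1 : 0 < 1 - t := by linarith
    have hinv : (1 - t)⁻¹ ≤ 1 + 2 * t := by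
      rw [inv_eq_one_div, div_le_iff₀ hpos1]; nlinarith
    have e2 : (2 : ℝ) * c / U = 2 * (c / U) := by ring
    calc -(2 * c / U) ≤ -(2 * t) := by rw [e2]; linarith [htU]
      _ ≤ 1 - (1 - t)⁻¹ := by linarith
      _ ≤ Real.log (1 - t) := Real.one_sub_inv_le_log_of_pos hpos1
      _ ≤ Real.log P := Real.log_le_log hpos1 hP1
  rw [hlogeq, abs_le]
  exact ⟨hlow, hup.trans hinvU'⟩

/-- **The coprime harmonic window**: for `k ≥ 1` and `1 ≤ U ≤ V ≤ 4U`,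
`|∑_{U<m≤V,(m,k)=1} 1/m − (φ(k)/k) log(V/U)| ≤ 10 τ(k)/U`. [folklore] -/
theorem abs_copWin_sub_le {k : ℕ} (hk : k ≠ 0) {U V : ℕ} (hU : 1 ≤ U) (hUV : U ≤ V) (hV4 : V ≤ 4 * U) :
    |copWin k U V - (Nat.totient k : ℝ) / k * Real.log ((V : ℝ) / U)| ≤ 10 * (σ 0 k : ℝ) / U := by
  have hU0 : (0 : ℝ) < U := by exact_mod_cast hU
  have hV1 : 1 ≤ V := hU.trans hUV
  have hV0 : (0 : ℝ) < V := by exact_mod_cast hV1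
  have hVU1 : (1 : ℝ) ≤ (V : ℝ) / U := by rw [le_div_iff₀ hU0, one_mul]; exact_mod_cast hUV
  have hVU4 : (V : ℝ) / U ≤ 4 := by rw [div_le_iff₀ hU0]; exact_mod_cast hV4
  have hlog0 : 0 ≤ Real.log ((V : ℝ) / U) := Real.log_nonneg hVU1
  have hlog4 : Real.log ((V : ℝ) / U) ≤ 1.4 := by
    calc Real.log ((V : ℝ) / U) ≤ Real.log 4 := Real.log_le_log (by positivity) hVU4
      _ = 2 * Real.log 2 := by rw [show (4 : ℝ) = 2 ^ 2 by norm_num, Real.log_pow]; norm_num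
      _ ≤ 1.4 := by have := Real.log_two_lt_d9; linarith
  rw [copWin_eq_sum_moebius hk, ← SquarefreeSums.sum_divisors_moebius_div k hk, Finset.sum_mul,
    ← Finset.sum_sub_distrib]
  -- termwise bound `10/U`
  have hterm : ∀ c ∈ k.divisors, |(μ c : ℝ) / c * ∑ m ∈ Ioc (U / c) (V / c), (1 : ℝ) / m -
      (μ c : ℝ) / c * Real.log ((V : ℝ) / U)| ≤ 10 / U := by
    intro c hc
    have hc0 : 0 < c := Nat.pos_of_mem_divisors hc
    have hc0' : (0 : ℝ) < c := by exact_mod_cast hc0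
    have hμ : |(μ c : ℝ)| ≤ 1 := by exact_mod_cast ArithmeticFunction.abs_moebius_le_one
    rw [← mul_sub, abs_mul, abs_div, Nat.abs_cast]
    set H := ∑ m ∈ Ioc (U / c) (V / c), (1 : ℝ) / m with hH
    have hH0 : 0 ≤ H := Finset.sum_nonneg fun _ _ => by positivity
    have hcoef : |(μ c : ℝ)| / c ≤ 1 / c := div_le_div_of_nonneg_right hμ hc0'.le
    by_cases h2c : 2 * c ≤ U
    · -- `U/c ≥ 2`: compare with the harmonic window at `(U/c, V/c]`
      obtain ⟨hlogabs, hinvU'⟩ := abs_log_div_floor_sub_le hc0 h2c hUV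
      have hU'1 : 1 ≤ U / c := by rw [Nat.le_div_iff_mul_le hc0]; omega
      have hU'V' : U / c ≤ V / c := Nat.div_le_div_right hUV
      have hwin := abs_sum_Ioc_inv_sub_log_le hU'1 hU'V'
      rw [← hH] at hwin
      have hU'0 : (0 : ℝ) < ((U / c : ℕ) : ℝ) := by exact_mod_cast hU'1
      -- `|H − log(V/U)| ≤ 2/U' + 2c/U ≤ 6c/U`
      have hHlog : |H - Real.log ((V : ℝ) / U)| ≤ 6 * c / U := by
        have htri := abs_sub_le H (Real.log (((V / c : ℕ) : ℝ) / ((U / c : ℕ) : ℝ))) (Real.log ((V : ℝ) / U))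
        have h3 : 2 / ((U / c : ℕ) : ℝ) ≤ 4 * c / U := by
          have := hinvU'; rw [div_le_div_iff₀ hU'0 hU0] at this ⊢; linarith
        have e6 : (6 : ℝ) * c / U = 4 * c / U + 2 * c / U := by ring
        linarith [hwin, hlogabs]
      calc |(μ c : ℝ)| / c * |H - Real.log ((V : ℝ) / U)| ≤ 1 / c * (6 * c / U) :=
            mul_le_mul hcoef hHlog (abs_nonneg _) (by positivity)
        _ = 6 / U := by field_simp
        _ ≤ 10 / U := by gcongr; norm_num
    · -- `c > U/2`: the coefficient `1/c < 2/U` and the window is short (`V/c ≤ 7`)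
      push Not at h2c
      have hcU : 1 / (c : ℝ) ≤ 2 / U := by
        rw [div_le_div_iff₀ hc0' hU0]
        have : (U : ℝ) < 2 * c := by exact_mod_cast h2c
        linarith
      have hVc7 : V / c ≤ 7 := by
        have : V / c < 8 := by
          rw [Nat.div_lt_iff_lt_mul hc0]; omega
        omega
      have hH3 : H ≤ 3 := by
        rcases Nat.eq_zero_or_pos (V / c) with h0 | hpos
        · rw [hH, h0]
          have : Ioc (U / c) 0 = ∅ := by ext m; simp
          rw [this, Finset.sum_empty]; norm_num
        · calc H ≤ 1 + Real.log ((V / c : ℕ) : ℝ) := sum_Ioc_inv_le_one_add_log _ _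
            _ ≤ 1 + Real.log 7 := by
                gcongr
                exact_mod_cast hVc7
            _ ≤ 3 := by have := log_seven_lt_two; linarith
      have hHlog : |H - Real.log ((V : ℝ) / U)| ≤ 4.4 := by
        rw [abs_le]; constructor <;> linarith
      calc |(μ c : ℝ)| / c * |H - Real.log ((V : ℝ) / U)| ≤ 2 / U * 4.4 :=
            mul_le_mul (hcoef.trans hcU) hHlog (abs_nonneg _) (by positivity)
        _ ≤ 10 / U := by rw [div_mul_eq_mul_div]; gcongr; norm_num
  calc |∑ c ∈ k.divisors, ((μ c : ℝ) / c * ∑ m ∈ Ioc (U / c) (V / c), (1 : ℝ) / m -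
          (μ c : ℝ) / c * Real.log ((V : ℝ) / U))|
      ≤ ∑ c ∈ k.divisors, |(μ c : ℝ) / c * ∑ m ∈ Ioc (U / c) (V / c), (1 : ℝ) / m -
          (μ c : ℝ) / c * Real.log ((V : ℝ) / U)| := Finset.abs_sum_le_sum_abs _ _
    _ ≤ ∑ c ∈ k.divisors, (10 : ℝ) / U := Finset.sum_le_sum hterm
    _ = 10 * (σ 0 k : ℝ) / U := by
        rw [Finset.sum_const, nsmul_eq_mul, ArithmeticFunction.sigma_zero_apply]; ring

/-! ### `1/φ(rn)` as a divisor sum over squarefree `e ∣ n` coprime to `r` -/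

/-- `φ(r a b) φ(r) = φ(r a) φ(r b)` for coprime `a, b` and `r ≥ 1`. [folklore] -/
theorem totient_mul_mul_mul_totient {r a b : ℕ} (hr : 0 < r) (hab : a.Coprime b) :
    Nat.totient (r * a * b) * Nat.totient r = Nat.totient (r * a) * Nat.totient (r * b) := by
  have hg : Nat.gcd (r * a) b = Nat.gcd r b := Nat.Coprime.gcd_mul_right_cancel r hab
  have h1 := Nat.totient_gcd_mul_totient_mul (r * a) b
  have h2 := Nat.totient_gcd_mul_totient_mul r b
  rw [hg] at h1
  set G := Nat.totient (Nat.gcd r b) with hG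
  have hGpos : 0 < G := Nat.totient_pos.2 (Nat.gcd_pos_of_pos_left b hr)
  have : G * (Nat.totient (r * a * b) * Nat.totient r) = G * (Nat.totient (r * a) * Nat.totient (r * b)) := by
    calc G * (Nat.totient (r * a * b) * Nat.totient r)
        = (G * Nat.totient (r * a * b)) * Nat.totient r := by ring
      _ = (Nat.totient (r * a) * Nat.totient b * Nat.gcd r b) * Nat.totient r := by rw [h1]
      _ = Nat.totient (r * a) * (Nat.totient r * Nat.totient b * Nat.gcd r b) := by ring
      _ = Nat.totient (r * a) * (G * Nat.totient (r * b)) := by rw [h2]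
      _ = G * (Nat.totient (r * a) * Nat.totient (r * b)) := by ring
  exact Nat.eq_of_mul_eq_mul_left hGpos this

/-- `φ(r p^i) = p^i φ(r)` when the prime `p` divides `r`. [folklore] -/
theorem totient_mul_prime_pow_of_dvd {p r : ℕ} (hp : p.Prime) (hpr : p ∣ r) (i : ℕ) :
    Nat.totient (r * p ^ i) = p ^ i * Nat.totient r := by
  induction i with
  | zero => simp
  | succ i ih =>
    have : r * p ^ (i + 1) = p * (r * p ^ i) := by ring
    rw [this, Nat.totient_mul_of_prime_of_dvd hp (hpr.mul_right _), ih, pow_succ]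
    ring

/-- The arithmetic function `n ↦ n φ(r)/φ(rn)` (and `0 ↦ 0`). [folklore] -/
def totRatio (r : ℕ) : ArithmeticFunction ℝ :=
  ⟨fun n => if n = 0 then 0 else (n : ℝ) * Nat.totient r / Nat.totient (r * n), by simp⟩

/-- The arithmetic function `e ↦ [e squarefree, (e, r) = 1]/φ(e)` (and `0 ↦ 0`). [folklore] -/
def sqfCop (r : ℕ) : ArithmeticFunction ℝ :=
  ⟨fun e => if e = 0 then 0 else if Squarefree e ∧ e.Coprime r then 1 / (Nat.totient e : ℝ) else 0,
    by simp⟩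

/-- `totRatio r n = n φ(r)/φ(rn)` for `n ≥ 1`. [folklore] -/
theorem totRatio_apply {r n : ℕ} (hn : n ≠ 0) :
    totRatio r n = (n : ℝ) * Nat.totient r / Nat.totient (r * n) := by
  unfold totRatio; simp [hn]

/-- `sqfCop r e = [e squarefree, (e, r) = 1]/φ(e)` for `e ≥ 1`. [folklore] -/
theorem sqfCop_apply {r e : ℕ} (he : e ≠ 0) :
    sqfCop r e = if Squarefree e ∧ e.Coprime r then 1 / (Nat.totient e : ℝ) else 0 := by
  unfold sqfCop; simp [he]

/-- `totRatio r` is multiplicative (`r ≥ 1`). [folklore] -/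
theorem isMultiplicative_totRatio {r : ℕ} (hr : 0 < r) : (totRatio r).IsMultiplicative := by
  have hφr : (0 : ℝ) < Nat.totient r := by exact_mod_cast Nat.totient_pos.2 hr
  refine ⟨?_, ?_⟩
  · rw [totRatio_apply one_ne_zero, mul_one, Nat.cast_one, one_mul, div_self hφr.ne']
  · intro m n hmn
    rcases Nat.eq_zero_or_pos m with hm | hm
    · subst hm; simp [totRatio]
    rcases Nat.eq_zero_or_pos n with hn | hn
    · subst hn; simp [totRatio]
    rw [totRatio_apply (Nat.mul_pos hm hn).ne', totRatio_apply hm.ne', totRatio_apply hn.ne']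
    have hφm : (0 : ℝ) < Nat.totient (r * m) := by exact_mod_cast Nat.totient_pos.2 (Nat.mul_pos hr hm)
    have hφn : (0 : ℝ) < Nat.totient (r * n) := by exact_mod_cast Nat.totient_pos.2 (Nat.mul_pos hr hn)
    have hφmn : (0 : ℝ) < Nat.totient (r * (m * n)) :=
      by exact_mod_cast Nat.totient_pos.2 (Nat.mul_pos hr (Nat.mul_pos hm hn))
    have key : (Nat.totient (r * m * n) : ℝ) * Nat.totient r = Nat.totient (r * m) * Nat.totient (r * n) := by
      exact_mod_cast totient_mul_mul_mul_totient hr hmn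
    rw [mul_assoc] at key
    rw [div_mul_div_comm, div_eq_div_iff hφmn.ne' (mul_pos hφm hφn).ne', Nat.cast_mul]
    calc (m : ℝ) * n * Nat.totient r * (Nat.totient (r * m) * Nat.totient (r * n))
        = (m : ℝ) * n * Nat.totient r * (Nat.totient (r * (m * n)) * Nat.totient r) := by rw [key]
      _ = (m : ℝ) * Nat.totient r * (n * Nat.totient r) * Nat.totient (r * (m * n)) := by ring

/-- `sqfCop r` is multiplicative. [folklore] -/
theorem isMultiplicative_sqfCop (r : ℕ) : (sqfCop r).IsMultiplicative := by
  refine ⟨?_, ?_⟩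
  · rw [sqfCop_apply one_ne_zero, if_pos ⟨squarefree_one, Nat.coprime_one_left r⟩]; simp
  · intro m n hmn
    rcases Nat.eq_zero_or_pos m with hm | hm
    · subst hm; simp [sqfCop]
    rcases Nat.eq_zero_or_pos n with hn | hn
    · subst hn; simp [sqfCop]
    rw [sqfCop_apply (Nat.mul_pos hm hn).ne', sqfCop_apply hm.ne', sqfCop_apply hn.ne']
    have hsq : Squarefree (m * n) ↔ Squarefree m ∧ Squarefree n := Nat.squarefree_mul hmn
    have hco : (m * n).Coprime r ↔ m.Coprime r ∧ n.Coprime r := Nat.coprime_mul_iff_left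
    by_cases h1 : Squarefree m ∧ m.Coprime r
    · by_cases h2 : Squarefree n ∧ n.Coprime r
      · rw [if_pos (⟨hsq.2 ⟨h1.1, h2.1⟩, hco.2 ⟨h1.2, h2.2⟩⟩), if_pos h1, if_pos h2,
          Nat.totient_mul hmn, Nat.cast_mul, one_div_mul_one_div]
      · rw [if_pos h1, if_neg h2, mul_zero, if_neg]
        rintro ⟨hs, hc⟩
        exact h2 ⟨(hsq.1 hs).2, (hco.1 hc).2⟩
    · rw [if_neg h1, zero_mul, if_neg]
      rintro ⟨hs, hc⟩
      exact h1 ⟨(hsq.1 hs).1, (hco.1 hc).1⟩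

/-- **`n φ(r)/φ(rn) = ∑_{e ∣ n} [e squarefree, (e,r)=1]/φ(e)`** as arithmetic functions:
`totRatio r = sqfCop r * ζ` (checked on prime powers: both sides are `1` if `p ∣ r` and `p/(p−1)`
otherwise). [folklore] -/
theorem totRatio_eq_sqfCop_mul_zeta {r : ℕ} (hr : 0 < r) :
    totRatio r = sqfCop r * (ζ : ArithmeticFunction ℝ) := by
  have hζ : (ζ : ArithmeticFunction ℝ).IsMultiplicative := ArithmeticFunction.isMultiplicative_zeta.natCast
  rw [ArithmeticFunction.IsMultiplicative.eq_iff_eq_on_prime_powers _ (isMultiplicative_totRatio hr) _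
    ((isMultiplicative_sqfCop r).mul hζ)]
  intro p i hp
  haveI := Fact.mk hp
  have hφr : (0 : ℝ) < Nat.totient r := by exact_mod_cast Nat.totient_pos.2 hr
  have hp1 : (1 : ℝ) < p := by exact_mod_cast hp.one_lt
  -- the right side: `∑_{j ≤ i} sqfCop r (p^j) = 1 + [i ≥ 1] sqfCop r p`
  rw [ArithmeticFunction.coe_mul_zeta_apply, Nat.divisors_prime_pow hp, Finset.sum_map]
  simp only [Function.Embedding.coeFn_mk]
  have h0 : sqfCop r 1 = 1 := by
    rw [sqfCop_apply one_ne_zero, if_pos ⟨squarefree_one, Nat.coprime_one_left r⟩]; simp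
  have hj2 : ∀ j, sqfCop r (p ^ (j + 1 + 1)) = 0 := by
    intro j
    rw [sqfCop_apply (pow_ne_zero _ hp.ne_zero), if_neg]
    rintro ⟨hs, -⟩
    rw [Nat.squarefree_pow_iff hp.ne_one (by omega)] at hs
    omega
  have hS : ∑ j ∈ range (i + 1), sqfCop r (p ^ j) = 1 + (if 1 ≤ i then sqfCop r p else 0) := by
    rcases i with _ | k
    · simp [h0]
    · rw [Finset.sum_range_succ', Finset.sum_range_succ', if_pos (by omega)]
      simp only [zero_add, pow_one, pow_zero, hj2, Finset.sum_const_zero, h0]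
      ring
  rw [hS]
  -- the left side
  rcases Nat.eq_zero_or_pos i with hi | hi
  · subst hi
    rw [if_neg (by omega), pow_zero, (isMultiplicative_totRatio hr).map_one]; simp
  rw [if_pos (show 1 ≤ i from hi), totRatio_apply (pow_ne_zero _ hp.ne_zero), sqfCop_apply hp.ne_zero]
  by_cases hpr : p ∣ r
  · -- `p ∣ r`: `φ(r p^i) = p^i φ(r)` and `p` is not coprime to `r`
    rw [totient_mul_prime_pow_of_dvd hp hpr, if_neg (fun h => ?_)]
    · push_cast
      field_simp
      simp
    · exact (Nat.Prime.coprime_iff_not_dvd hp).1 h.2 hpr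
  · -- `p ∤ r`: `φ(r p^i) = φ(r) p^{i-1}(p-1)` and `sqfCop r p = 1/(p-1)`
    have hcop : Nat.Coprime r (p ^ i) := Nat.Coprime.pow_right i ((Nat.Prime.coprime_iff_not_dvd hp).2 hpr).symm
    rw [Nat.totient_mul hcop, Nat.totient_prime_pow hp hi,
      if_pos ⟨hp.squarefree, (Nat.Prime.coprime_iff_not_dvd hp).2 hpr⟩, Nat.totient_prime hp]
    have hpi : (p : ℝ) ^ i = p ^ (i - 1) * p := by
      rw [← pow_succ]; congr 1; omega
    push_cast
    rw [Nat.cast_sub hp.one_le, Nat.cast_one, hpi]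
    have hp0 : (p : ℝ) - 1 ≠ 0 := by linarith
    have hppos : (0 : ℝ) < p ^ (i - 1) := by positivity
    field_simp
    ring

/-- **`1/φ(rn) = (1/(φ(r) n)) ∑_{e ∣ n, e squarefree, (e, r) = 1} 1/φ(e)`** for `r, n ≥ 1`. [folklore] -/
theorem inv_totient_mul_eq {r n : ℕ} (hr : 0 < r) (hn : 0 < n) :
    (1 : ℝ) / Nat.totient (r * n) =
      1 / ((Nat.totient r : ℝ) * n) *
        ∑ e ∈ n.divisors.filter (fun e => Squarefree e ∧ e.Coprime r), (1 : ℝ) / Nat.totient e := by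
  have h : totRatio r n = (sqfCop r * (ζ : ArithmeticFunction ℝ)) n := by
    rw [totRatio_eq_sqfCop_mul_zeta hr]
  rw [totRatio_apply hn.ne', ArithmeticFunction.coe_mul_zeta_apply] at h
  have hsum : ∑ e ∈ n.divisors, sqfCop r e =
      ∑ e ∈ n.divisors.filter (fun e => Squarefree e ∧ e.Coprime r), (1 : ℝ) / Nat.totient e := by
    rw [Finset.sum_filter]
    refine Finset.sum_congr rfl fun e he => ?_
    rw [sqfCop_apply (Nat.pos_of_mem_divisors he).ne']
  rw [← hsum, ← h]
  have hφr : (0 : ℝ) < Nat.totient r := by exact_mod_cast Nat.totient_pos.2 hr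
  have hφrn : (0 : ℝ) < Nat.totient (r * n) := by exact_mod_cast Nat.totient_pos.2 (Nat.mul_pos hr hn)
  have hn0 : (0 : ℝ) < n := by exact_mod_cast hn
  field_simp

/-! ### The windows of `∑_{(n,k)=1} 1/φ(rn)` -/

/-- `W(U, V) = ∑_{U < n ≤ V, (n, k) = 1} 1/φ(rn)`. [folklore] -/
def phiWin (r k U V : ℕ) : ℝ :=
  ∑ n ∈ (Ioc U V).filter (fun n : ℕ => n.Coprime k), (1 : ℝ) / Nat.totient (r * n)

/-- `Φ(V) = ∑_{e ≤ V} 1/φ(e)`. [folklore] -/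
def totInvSum (V : ℕ) : ℝ := ∑ e ∈ Icc 1 V, (1 : ℝ) / Nat.totient e

/-- `Σ₁(V) = ∑_{e ≤ V, e squarefree, (e, r) = (e, k) = 1} 1/(e φ(e))`. [folklore] -/
def sig1 (r k V : ℕ) : ℝ :=
  ∑ e ∈ (Icc 1 V).filter (fun e : ℕ => Squarefree e ∧ e.Coprime r ∧ e.Coprime k),
    (1 : ℝ) / ((e : ℝ) * Nat.totient e)

/-- `phiWin ≥ 0`. [folklore] -/
theorem phiWin_nonneg (r k U V : ℕ) : 0 ≤ phiWin r k U V :=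
  Finset.sum_nonneg fun _ _ => by positivity

/-- `Φ(V) ≥ 0`. [folklore] -/
theorem totInvSum_nonneg (V : ℕ) : 0 ≤ totInvSum V := Finset.sum_nonneg fun _ _ => by positivity

/-- `Φ` is monotone. [folklore] -/
theorem totInvSum_mono {V V' : ℕ} (h : V ≤ V') : totInvSum V ≤ totInvSum V' :=
  Finset.sum_le_sum_of_subset_of_nonneg (Finset.Icc_subset_Icc_right h) (fun _ _ _ => by positivity)

/-- `0 ≤ Σ₁(V) ≤ Φ(V)`. [folklore] -/
theorem sig1_nonneg (r k V : ℕ) : 0 ≤ sig1 r k V := Finset.sum_nonneg fun _ _ => by positivity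

/-- `Σ₁(V) ≤ Φ(V)`. [folklore] -/
theorem sig1_le_totInvSum (r k V : ℕ) : sig1 r k V ≤ totInvSum V := by
  unfold sig1 totInvSum
  calc ∑ e ∈ (Icc 1 V).filter (fun e : ℕ => Squarefree e ∧ e.Coprime r ∧ e.Coprime k),
        (1 : ℝ) / ((e : ℝ) * Nat.totient e)
      ≤ ∑ e ∈ (Icc 1 V).filter (fun e : ℕ => Squarefree e ∧ e.Coprime r ∧ e.Coprime k),
        (1 : ℝ) / Nat.totient e := by
        refine Finset.sum_le_sum fun e he => ?_
        have he1 : (1 : ℝ) ≤ e := by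
          have := (Finset.mem_Icc.1 (Finset.mem_filter.1 he).1).1; exact_mod_cast this
        rcases Nat.eq_zero_or_pos (Nat.totient e) with h0 | h0
        · simp [h0]
        · have hφ : (0 : ℝ) < Nat.totient e := by exact_mod_cast h0
          rw [div_le_div_iff₀ (by positivity) hφ, one_mul, one_mul]
          exact le_mul_of_one_le_left hφ.le he1
    _ ≤ ∑ e ∈ Icc 1 V, (1 : ℝ) / Nat.totient e :=
        Finset.sum_le_sum_of_subset_of_nonneg (Finset.filter_subset _ _) (fun _ _ _ => by positivity)

/-- `|Σ₁(V) − Σ₁(V')| ≤ Φ(max V V')/min V V'` (for `V, V' ≥ 1`). [folklore] -/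
theorem abs_sig1_sub_sig1_le (r k : ℕ) {V V' : ℕ} (hV : 1 ≤ V) (hV' : 1 ≤ V') :
    |sig1 r k V - sig1 r k V'| ≤ totInvSum (max V V') / ((min V V' : ℕ) : ℝ) := by
  -- reduce to `V ≤ V'`
  wlog hle : V ≤ V' generalizing V V'
  · have := this hV' hV (le_of_not_ge hle)
    rwa [abs_sub_comm, max_comm, min_comm] at this
  rw [max_eq_right hle, min_eq_left hle]
  have hV0 : (0 : ℝ) < V := by exact_mod_cast hV
  -- `Σ₁(V') − Σ₁(V)` is the sum over `V < e ≤ V'`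
  have hsplit : sig1 r k V' = sig1 r k V +
      ∑ e ∈ (Ioc V V').filter (fun e : ℕ => Squarefree e ∧ e.Coprime r ∧ e.Coprime k),
        (1 : ℝ) / ((e : ℝ) * Nat.totient e) := by
    unfold sig1
    rw [← Finset.sum_union]
    · rw [← Finset.filter_union]
      congr 2
      ext e; simp only [Finset.mem_union, Finset.mem_Icc, Finset.mem_Ioc]; omega
    · rw [Finset.disjoint_left]
      intro e h1 h2
      have a := (Finset.mem_Icc.1 (Finset.mem_filter.1 h1).1).2
      have b := (Finset.mem_Ioc.1 (Finset.mem_filter.1 h2).1).1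
      omega
  have hdiff : sig1 r k V - sig1 r k V' =
      -∑ e ∈ (Ioc V V').filter (fun e : ℕ => Squarefree e ∧ e.Coprime r ∧ e.Coprime k),
        (1 : ℝ) / ((e : ℝ) * Nat.totient e) := by
    rw [hsplit]; ring
  rw [hdiff, abs_neg, abs_of_nonneg (Finset.sum_nonneg fun _ _ => by positivity)]
  calc ∑ e ∈ (Ioc V V').filter (fun e : ℕ => Squarefree e ∧ e.Coprime r ∧ e.Coprime k),
        (1 : ℝ) / ((e : ℝ) * Nat.totient e)
      ≤ ∑ e ∈ (Ioc V V').filter (fun e : ℕ => Squarefree e ∧ e.Coprime r ∧ e.Coprime k),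
        (1 : ℝ) / Nat.totient e / V := by
        refine Finset.sum_le_sum fun e he => ?_
        have heV : (V : ℝ) ≤ e := by
          have := (Finset.mem_Ioc.1 (Finset.mem_filter.1 he).1).1; exact_mod_cast this.le
        have he0 : (0 : ℝ) < e := lt_of_lt_of_le hV0 heV
        rcases Nat.eq_zero_or_pos (Nat.totient e) with h0 | h0
        · simp [h0]
        · have hφ : (0 : ℝ) < Nat.totient e := by exact_mod_cast h0
          rw [div_div, div_le_div_iff₀ (by positivity) (by positivity), one_mul, one_mul]
          nlinarith
    _ ≤ ∑ e ∈ Icc 1 V', (1 : ℝ) / Nat.totient e / V := by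
        refine Finset.sum_le_sum_of_subset_of_nonneg (fun e he => ?_) (fun _ _ _ => by positivity)
        have := Finset.mem_Ioc.1 (Finset.mem_filter.1 he).1
        rw [Finset.mem_Icc]; omega
    _ = totInvSum V' / V := by rw [totInvSum, Finset.sum_div]

/-- **`W(U,V) ≤ Φ(V)/φ(r)`** (from `φ(rn) ≥ φ(r)φ(n)`). [folklore] -/
theorem phiWin_le {r : ℕ} (hr : 0 < r) (k U V : ℕ) : phiWin r k U V ≤ totInvSum V / Nat.totient r := by
  have hφr : (0 : ℝ) < Nat.totient r := by exact_mod_cast Nat.totient_pos.2 hr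
  unfold phiWin totInvSum
  rw [Finset.sum_div]
  calc ∑ n ∈ (Ioc U V).filter (fun n : ℕ => n.Coprime k), (1 : ℝ) / Nat.totient (r * n)
      ≤ ∑ n ∈ (Ioc U V).filter (fun n : ℕ => n.Coprime k), (1 : ℝ) / Nat.totient n / Nat.totient r := by
        refine Finset.sum_le_sum fun n hn => ?_
        have hn1 : 1 ≤ n := by have := (Finset.mem_Ioc.1 (Finset.mem_filter.1 hn).1).1; omega
        have hφn : (0 : ℝ) < Nat.totient n := by exact_mod_cast Nat.totient_pos.2 hn1
        have hsm : (Nat.totient r : ℝ) * Nat.totient n ≤ Nat.totient (r * n) := by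
          exact_mod_cast Nat.totient_super_multiplicative r n
        rw [div_div, div_le_div_iff₀ (by positivity) (by positivity), one_mul, one_mul, mul_comm]
        exact hsm
    _ ≤ ∑ n ∈ Icc 1 V, (1 : ℝ) / Nat.totient n / Nat.totient r := by
        refine Finset.sum_le_sum_of_subset_of_nonneg (fun n hn => ?_) (fun _ _ _ => by positivity)
        have := Finset.mem_Ioc.1 (Finset.mem_filter.1 hn).1
        rw [Finset.mem_Icc]; omega

/-- **The hyperbola decomposition of the window**:
`W(U,V) = (1/φ(r)) ∑_{e ≤ V, e sqfree, (e,r)=(e,k)=1} (1/(eφ(e))) · copWin k (U/e) (V/e)`. [folklore] -/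
theorem phiWin_eq_sum {r : ℕ} (hr : 0 < r) (k U V : ℕ) :
    phiWin r k U V = 1 / (Nat.totient r : ℝ) *
      ∑ e ∈ (Icc 1 V).filter (fun e : ℕ => Squarefree e ∧ e.Coprime r ∧ e.Coprime k),
        (1 : ℝ) / ((e : ℝ) * Nat.totient e) * copWin k (U / e) (V / e) := by
  have hφr : (0 : ℝ) < Nat.totient r := by exact_mod_cast Nat.totient_pos.2 hr
  -- step 1: insert the divisor sum and write it over `e ∈ Icc 1 V`
  have step1 : ∀ n ∈ (Ioc U V).filter (fun n : ℕ => n.Coprime k),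
      (1 : ℝ) / Nat.totient (r * n) =
        ∑ e ∈ Icc 1 V, (if e ∣ n ∧ Squarefree e ∧ e.Coprime r then
          1 / ((Nat.totient r : ℝ) * n) * (1 / (Nat.totient e : ℝ)) else 0) := by
    intro n hn
    have hn' := Finset.mem_Ioc.1 (Finset.mem_filter.1 hn).1
    have hn0 : 0 < n := by omega
    rw [inv_totient_mul_eq hr hn0, Finset.mul_sum, Finset.sum_filter]
    -- `n.divisors ⊆ Icc 1 V`
    have hsub : n.divisors ⊆ Icc 1 V := by
      intro e he
      rw [Finset.mem_Icc]
      exact ⟨Nat.pos_of_mem_divisors he, (Nat.divisor_le he).trans hn'.2⟩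
    rw [← Finset.sum_subset hsub (f := fun e => if e ∣ n ∧ Squarefree e ∧ e.Coprime r then
          1 / ((Nat.totient r : ℝ) * n) * (1 / (Nat.totient e : ℝ)) else 0)
        (fun e _ hen => by
          rw [if_neg]
          rintro ⟨hd, -⟩
          exact hen (Nat.mem_divisors.2 ⟨hd, hn0.ne'⟩))]
    refine Finset.sum_congr rfl fun e he => ?_
    have hen : e ∣ n := Nat.dvd_of_mem_divisors he
    by_cases h : Squarefree e ∧ e.Coprime r
    · rw [if_pos h, if_pos ⟨hen, h⟩]
    · rw [if_neg h, if_neg (fun h' => h h'.2)]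
  unfold phiWin
  rw [Finset.sum_congr rfl step1, Finset.sum_comm, Finset.mul_sum, Finset.sum_filter]
  refine Finset.sum_congr rfl fun e he => ?_
  have he1 : 0 < e := (Finset.mem_Icc.1 he).1
  have he0 : (e : ℝ) ≠ 0 := by exact_mod_cast he1.ne'
  by_cases hP : Squarefree e ∧ e.Coprime r ∧ e.Coprime k
  · rw [if_pos hP]
    -- the `n`-sum: only multiples of `e`, `n = e m`
    have hinner : ∑ n ∈ (Ioc U V).filter (fun n : ℕ => n.Coprime k),
        (if e ∣ n ∧ Squarefree e ∧ e.Coprime r then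
          1 / ((Nat.totient r : ℝ) * n) * (1 / (Nat.totient e : ℝ)) else 0) =
        ∑ n ∈ (Ioc U V).filter (fun n : ℕ => e ∣ n),
          (if n.Coprime k then 1 / ((Nat.totient r : ℝ) * n) * (1 / (Nat.totient e : ℝ)) else 0) := by
      rw [Finset.sum_filter, Finset.sum_filter]
      refine Finset.sum_congr rfl fun n _ => ?_
      by_cases h1 : n.Coprime k
      · by_cases h2 : e ∣ n
        · rw [if_pos h1, if_pos ⟨h2, hP.1, hP.2.1⟩, if_pos h2, if_pos h1]
        · rw [if_pos h1, if_neg (fun h => h2 h.1), if_neg h2]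
      · by_cases h2 : e ∣ n
        · rw [if_neg h1, if_pos h2, if_neg h1]
        · rw [if_neg h1, if_neg h2]
    rw [hinner, filter_dvd_Ioc_eq_image he1, Finset.sum_image
      (fun x _ y _ h => Nat.eq_of_mul_eq_mul_left he1 h)]
    unfold copWin
    rw [Finset.sum_filter, Finset.mul_sum, Finset.mul_sum]
    refine Finset.sum_congr rfl fun m _ => ?_
    have hcop : (e * m).Coprime k ↔ m.Coprime k := by
      rw [Nat.coprime_mul_iff_left]
      exact ⟨fun h => h.2, fun h => ⟨hP.2.2, h⟩⟩
    simp only [hcop]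
    by_cases hm : m.Coprime k
    · rw [if_pos hm, if_pos hm, Nat.cast_mul]
      rcases Nat.eq_zero_or_pos m with h0 | h0
      · subst h0; simp
      · have hm0 : (m : ℝ) ≠ 0 := by exact_mod_cast h0.ne'
        rcases Nat.eq_zero_or_pos (Nat.totient e) with hφ0 | hφ0
        · simp [hφ0]
        · have hφe : (Nat.totient e : ℝ) ≠ 0 := by exact_mod_cast hφ0.ne'
          field_simp
    · rw [if_neg hm, if_neg hm, mul_zero, mul_zero]
  · rw [if_neg hP]
    refine Finset.sum_eq_zero fun n hn => ?_
    rw [if_neg]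
    rintro ⟨hen, hsq, hcr⟩
    have hnk : n.Coprime k := (Finset.mem_filter.1 hn).2
    exact hP ⟨hsq, hcr, Nat.Coprime.coprime_dvd_left hen hnk⟩

/-- `log 3 ≤ 1.2`. [folklore] -/
theorem log_three_le : Real.log 3 ≤ 1.2 := by
  rw [Real.log_le_iff_le_exp (by norm_num)]
  have h1 := Real.exp_one_gt_d9
  have h2 : (1 : ℝ) + 0.2 ≤ Real.exp 0.2 := by
    have := Real.add_one_le_exp (0.2 : ℝ); linarith
  have : Real.exp 1.2 = Real.exp 1 * Real.exp 0.2 := by rw [← Real.exp_add]; norm_num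
  rw [this]; nlinarith [Real.exp_pos (0.2 : ℝ)]

/-- `log 8 ≤ 2.1`. [folklore] -/
theorem log_eight_le : Real.log 8 ≤ 2.1 := by
  rw [show (8 : ℝ) = 2 ^ 3 by norm_num, Real.log_pow]
  have := Real.log_two_lt_d9
  push_cast
  linarith

/-- **The main estimate for one window**: for `r, k ≥ 1` and `1 ≤ U ≤ V ≤ 3U`,
`|W(U,V) − (φ(k)/k) log(V/U) Σ₁(V)/φ(r)| ≤ 22 τ(k) Φ(V)/(φ(r) U)`. [folklore] -/
theorem abs_phiWin_sub_le {r k : ℕ} (hr : 0 < r) (hk : k ≠ 0) {U V : ℕ} (hU : 1 ≤ U) (hUV : U ≤ V)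
    (hV3 : V ≤ 3 * U) :
    |phiWin r k U V - (Nat.totient k : ℝ) / k * Real.log ((V : ℝ) / U) * sig1 r k V / Nat.totient r| ≤
      22 * (σ 0 k : ℝ) * totInvSum V / ((Nat.totient r : ℝ) * U) := by
  have hφr : (0 : ℝ) < Nat.totient r := by exact_mod_cast Nat.totient_pos.2 hr
  have hU0 : (0 : ℝ) < U := by exact_mod_cast hU
  have hV0 : (0 : ℝ) < V := by exact_mod_cast (hU.trans hUV)
  have hVU1 : (1 : ℝ) ≤ (V : ℝ) / U := by rw [le_div_iff₀ hU0, one_mul]; exact_mod_cast hUV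
  have hVU3 : (V : ℝ) / U ≤ 3 := by rw [div_le_iff₀ hU0]; exact_mod_cast hV3
  have hlog0 : 0 ≤ Real.log ((V : ℝ) / U) := Real.log_nonneg hVU1
  have hlog3 : Real.log ((V : ℝ) / U) ≤ 1.2 :=
    (Real.log_le_log (by positivity) hVU3).trans log_three_le
  have hα0 : 0 ≤ (Nat.totient k : ℝ) / k := by positivity
  have hα1 : (Nat.totient k : ℝ) / k ≤ 1 := by
    rcases Nat.eq_zero_or_pos k with h | h
    · exact absurd h hk
    · rw [div_le_one (by exact_mod_cast h)]; exact_mod_cast Nat.totient_le k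
  have hτ1 : (1 : ℝ) ≤ σ 0 k := by exact_mod_cast one_le_sigma_zero hk
  set F := (Icc 1 V).filter (fun e : ℕ => Squarefree e ∧ e.Coprime r ∧ e.Coprime k) with hF
  set α := (Nat.totient k : ℝ) / k with hαdef
  set L := Real.log ((V : ℝ) / U) with hLdef
  -- the difference as a single sum over `e`
  have hdiff : phiWin r k U V - α * L * sig1 r k V / Nat.totient r =
      1 / (Nat.totient r : ℝ) * ∑ e ∈ F, (1 : ℝ) / ((e : ℝ) * Nat.totient e) * (copWin k (U / e) (V / e) - α * L) := by
    have hsum : ∑ e ∈ F, (1 : ℝ) / ((e : ℝ) * Nat.totient e) * (copWin k (U / e) (V / e) - α * L) =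
        ∑ e ∈ F, (1 : ℝ) / ((e : ℝ) * Nat.totient e) * copWin k (U / e) (V / e) - α * L * sig1 r k V := by
      rw [sig1, ← hF, Finset.mul_sum, ← Finset.sum_sub_distrib]
      exact Finset.sum_congr rfl fun e _ => by ring
    rw [hsum, phiWin_eq_sum hr, ← hF]
    field_simp
  rw [hdiff, abs_mul, abs_of_pos (by positivity : (0 : ℝ) < 1 / Nat.totient r)]
  -- termwise bound
  have hterm : ∀ e ∈ F, |(1 : ℝ) / ((e : ℝ) * Nat.totient e) * (copWin k (U / e) (V / e) - α * L)| ≤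
      22 * (σ 0 k : ℝ) / U * (1 / Nat.totient e) := by
    intro e he
    have he' := Finset.mem_filter.1 he
    have he1 : 1 ≤ e := (Finset.mem_Icc.1 he'.1).1
    have he0 : (0 : ℝ) < e := by exact_mod_cast he1
    have hφe : (0 : ℝ) < Nat.totient e := by exact_mod_cast Nat.totient_pos.2 he1
    rw [abs_mul, abs_of_pos (by positivity : (0 : ℝ) < 1 / ((e : ℝ) * Nat.totient e))]
    -- it suffices to bound `|copWin − αL| ≤ 22 τ(k) e / U`
    suffices h : |copWin k (U / e) (V / e) - α * L| ≤ 22 * (σ 0 k : ℝ) * e / U by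
      calc (1 : ℝ) / ((e : ℝ) * Nat.totient e) * |copWin k (U / e) (V / e) - α * L|
          ≤ (1 : ℝ) / ((e : ℝ) * Nat.totient e) * (22 * (σ 0 k : ℝ) * e / U) :=
            mul_le_mul_of_nonneg_left h (by positivity)
        _ = 22 * (σ 0 k : ℝ) / U * (1 / Nat.totient e) := by field_simp
    by_cases h3e : 3 * e ≤ U
    · -- good `e`: `U/e ≥ 3`
      obtain ⟨hlogabs, hinvU'⟩ := abs_log_div_floor_sub_le (c := e) he1 (by omega) hUV
      have hU'3 : 3 ≤ U / e := by rw [Nat.le_div_iff_mul_le he1]; exact h3e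
      have hU'1 : 1 ≤ U / e := by omega
      have hU'V' : U / e ≤ V / e := Nat.div_le_div_right hUV
      have hV'4 : V / e ≤ 4 * (U / e) := by
        have hlt : U < U / e * e + e := Nat.lt_div_mul_add he1
        have h2 : 3 * U / e < 3 * (U / e) + 3 := by
          rw [Nat.div_lt_iff_lt_mul he1]
          have : (3 * (U / e) + 3) * e = 3 * (U / e * e + e) := by ring
          rw [this]; omega
        have h1 : V / e ≤ 3 * U / e := Nat.div_le_div_right hV3
        omega
      have hcw := abs_copWin_sub_le hk hU'1 hU'V' hV'4
      have hU'0 : (0 : ℝ) < ((U / e : ℕ) : ℝ) := by exact_mod_cast hU'1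
      -- `|copWin − αL| ≤ |copWin − α log(V'/U')| + α |log(V'/U') − L|`
      have h1 : |copWin k (U / e) (V / e) - α * L| ≤
          10 * (σ 0 k : ℝ) / ((U / e : ℕ) : ℝ) + α * (2 * e / U) := by
        have htri := abs_sub_le (copWin k (U / e) (V / e))
          (α * Real.log (((V / e : ℕ) : ℝ) / ((U / e : ℕ) : ℝ))) (α * L)
        have h2 : |α * Real.log (((V / e : ℕ) : ℝ) / ((U / e : ℕ) : ℝ)) - α * L| ≤ α * (2 * e / U) := by
          rw [← mul_sub, abs_mul, abs_of_nonneg hα0]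
          exact mul_le_mul_of_nonneg_left hlogabs hα0
        linarith
      have h2 : 10 * (σ 0 k : ℝ) / ((U / e : ℕ) : ℝ) ≤ 20 * (σ 0 k : ℝ) * e / U := by
        have := mul_le_mul_of_nonneg_left hinvU' (by positivity : (0 : ℝ) ≤ 10 * σ 0 k)
        calc 10 * (σ 0 k : ℝ) / ((U / e : ℕ) : ℝ) = 10 * (σ 0 k : ℝ) * (1 / ((U / e : ℕ) : ℝ)) := by ring
          _ ≤ 10 * (σ 0 k : ℝ) * (2 * e / U) := this
          _ = 20 * (σ 0 k : ℝ) * e / U := by ring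
      have h3 : α * (2 * e / U) ≤ 2 * (σ 0 k : ℝ) * e / U := by
        calc α * (2 * e / U) ≤ 1 * (2 * e / U) := mul_le_mul_of_nonneg_right hα1 (by positivity)
          _ ≤ (σ 0 k : ℝ) * (2 * e / U) := mul_le_mul_of_nonneg_right hτ1 (by positivity)
          _ = 2 * (σ 0 k : ℝ) * e / U := by ring
      calc |copWin k (U / e) (V / e) - α * L| ≤ 20 * (σ 0 k : ℝ) * e / U + 2 * (σ 0 k : ℝ) * e / U := by
            linarith
        _ = 22 * (σ 0 k : ℝ) * e / U := by ring
    · -- bad `e`: `1/e < 3/U`, and the window `(U/e, V/e]` has `V/e ≤ 8`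
      push Not at h3e
      have hVe : V / e ≤ 8 := by
        have : V / e < 9 := by rw [Nat.div_lt_iff_lt_mul he1]; omega
        omega
      have hcw0 : 0 ≤ copWin k (U / e) (V / e) := copWin_nonneg _ _ _
      have hlogVe : Real.log ((V / e : ℕ) : ℝ) ≤ 2.1 := by
        rcases Nat.eq_zero_or_pos (V / e) with h0 | h0
        · rw [h0, Nat.cast_zero, Real.log_zero]; norm_num
        · calc Real.log ((V / e : ℕ) : ℝ) ≤ Real.log 8 :=
              Real.log_le_log (by exact_mod_cast h0) (by exact_mod_cast hVe)
            _ ≤ 2.1 := log_eight_le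
      have hcw : copWin k (U / e) (V / e) ≤ 3.1 := by
        have h1 : copWin k (U / e) (V / e) ≤ ∑ m ∈ Ioc (U / e) (V / e), (1 : ℝ) / m :=
          Finset.sum_le_sum_of_subset_of_nonneg (Finset.filter_subset _ _) (fun _ _ _ => by positivity)
        have h2 := sum_Ioc_inv_le_one_add_log (U / e) (V / e)
        linarith
      have hαL : 0 ≤ α * L ∧ α * L ≤ 1.2 := by
        constructor
        · positivity
        · calc α * L ≤ 1 * 1.2 := mul_le_mul hα1 hlog3 hlog0 zero_le_one
            _ = 1.2 := one_mul _
      have habs : |copWin k (U / e) (V / e) - α * L| ≤ 4.3 := by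
        rw [abs_le]; constructor <;> linarith [hαL.1, hαL.2]
      have heU : (1 : ℝ) ≤ 3 * e / U := by
        rw [le_div_iff₀ hU0, one_mul]; exact_mod_cast h3e.le
      calc |copWin k (U / e) (V / e) - α * L| ≤ 4.3 * 1 := by linarith
        _ ≤ 4.3 * (3 * e / U) := mul_le_mul_of_nonneg_left heU (by norm_num)
        _ ≤ 22 * (σ 0 k : ℝ) * e / U := by
            rw [show (4.3 : ℝ) * (3 * e / U) = 12.9 * e / U by ring]
            rw [div_le_div_iff_of_pos_right hU0]
            nlinarith [he0]
  calc 1 / (Nat.totient r : ℝ) * |∑ e ∈ F, (1 : ℝ) / ((e : ℝ) * Nat.totient e) * (copWin k (U / e) (V / e) - α * L)|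
      ≤ 1 / (Nat.totient r : ℝ) * ∑ e ∈ F, (22 * (σ 0 k : ℝ) / U * (1 / Nat.totient e)) := by
        refine mul_le_mul_of_nonneg_left ((Finset.abs_sum_le_sum_abs _ _).trans (Finset.sum_le_sum hterm)) ?_
        positivity
    _ ≤ 1 / (Nat.totient r : ℝ) * (22 * (σ 0 k : ℝ) / U * totInvSum V) := by
        refine mul_le_mul_of_nonneg_left ?_ (by positivity)
        rw [← Finset.mul_sum]
        refine mul_le_mul_of_nonneg_left ?_ (by positivity)
        exact Finset.sum_le_sum_of_subset_of_nonneg (Finset.filter_subset _ _) (fun _ _ _ => by positivity)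
    _ = 22 * (σ 0 k : ℝ) * totInvSum V / ((Nat.totient r : ℝ) * U) := by
        field_simp

/-- **Two windows of ratio `≤ 3` differ by `O(Φ (|Δ log| + τ(k)(1/U + 1/U'))/φ(r))`**: for
`r, k ≥ 1`, `1 ≤ U ≤ V ≤ 3U`, `1 ≤ U' ≤ V' ≤ 3U'`,
`|W(U,V) − W(U',V')| ≤ (Φ(max V V')/φ(r)) (|log(V/U) − log(V'/U')| + 24 τ(k) (1/U + 1/U'))`.
[cite: BombieriFriedlanderIwaniecActa1986, §13 p. 241–242] -/
theorem abs_phiWin_sub_phiWin_le {r k : ℕ} (hr : 0 < r) (hk : k ≠ 0) {U V U' V' : ℕ}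
    (hU : 1 ≤ U) (hUV : U ≤ V) (hV3 : V ≤ 3 * U) (hU' : 1 ≤ U') (hUV' : U' ≤ V') (hV3' : V' ≤ 3 * U') :
    |phiWin r k U V - phiWin r k U' V'| ≤
      totInvSum (max V V') / Nat.totient r *
        (|Real.log ((V : ℝ) / U) - Real.log ((V' : ℝ) / U')| + 24 * (σ 0 k : ℝ) * (1 / U + 1 / U')) := by
  have hφr : (0 : ℝ) < Nat.totient r := by exact_mod_cast Nat.totient_pos.2 hr
  have hU0 : (0 : ℝ) < U := by exact_mod_cast hU
  have hU0' : (0 : ℝ) < U' := by exact_mod_cast hU'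
  have hV1 : 1 ≤ V := hU.trans hUV
  have hV1' : 1 ≤ V' := hU'.trans hUV'
  have hVU1 : (1 : ℝ) ≤ (V : ℝ) / U := by rw [le_div_iff₀ hU0, one_mul]; exact_mod_cast hUV
  have hVU3 : (V : ℝ) / U ≤ 3 := by rw [div_le_iff₀ hU0]; exact_mod_cast hV3
  have hlog0 : 0 ≤ Real.log ((V : ℝ) / U) := Real.log_nonneg hVU1
  have hlog3 : Real.log ((V : ℝ) / U) ≤ 1.2 := (Real.log_le_log (by positivity) hVU3).trans log_three_le
  have hα0 : 0 ≤ (Nat.totient k : ℝ) / k := by positivity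
  have hα1 : (Nat.totient k : ℝ) / k ≤ 1 := by
    rcases Nat.eq_zero_or_pos k with h | h
    · exact absurd h hk
    · rw [div_le_one (by exact_mod_cast h)]; exact_mod_cast Nat.totient_le k
  have hτ1 : (1 : ℝ) ≤ σ 0 k := by exact_mod_cast one_le_sigma_zero hk
  set α := (Nat.totient k : ℝ) / k with hαdef
  set L := Real.log ((V : ℝ) / U) with hLdef
  set L' := Real.log ((V' : ℝ) / U') with hL'def
  set Φ := totInvSum (max V V') with hΦdef
  have hΦ0 : 0 ≤ Φ := totInvSum_nonneg _
  have hΦV : totInvSum V ≤ Φ := totInvSum_mono (le_max_left _ _)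
  have hΦV' : totInvSum V' ≤ Φ := totInvSum_mono (le_max_right _ _)
  have hE := abs_phiWin_sub_le hr hk hU hUV hV3
  have hE' := abs_phiWin_sub_le hr hk hU' hUV' hV3'
  rw [← hαdef, ← hLdef] at hE
  rw [← hαdef, ← hL'def] at hE'
  -- the main terms
  have hS := abs_sig1_sub_sig1_le r k hV1 hV1'
  have hmin : totInvSum (max V V') / ((min V V' : ℕ) : ℝ) ≤ Φ * (1 / U + 1 / U') := by
    rw [← hΦdef, div_eq_mul_one_div]
    refine mul_le_mul_of_nonneg_left ?_ hΦ0
    rcases le_total V V' with h | h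
    · rw [min_eq_left h]
      have : 1 / (V : ℝ) ≤ 1 / U := one_div_le_one_div_of_le hU0 (by exact_mod_cast hUV)
      linarith [show (0 : ℝ) ≤ 1 / U' by positivity]
    · rw [min_eq_right h]
      have : 1 / (V' : ℝ) ≤ 1 / U' := one_div_le_one_div_of_le hU0' (by exact_mod_cast hUV')
      linarith [show (0 : ℝ) ≤ 1 / U by positivity]
  have hM : |α * L * sig1 r k V / Nat.totient r - α * L' * sig1 r k V' / Nat.totient r| ≤
      Φ / Nat.totient r * (|L - L'| + 1.2 * (1 / U + 1 / U')) := by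
    have e1 : α * L * sig1 r k V / Nat.totient r - α * L' * sig1 r k V' / Nat.totient r =
        α / Nat.totient r * (L * (sig1 r k V - sig1 r k V') + (L - L') * sig1 r k V') := by
      field_simp; ring
    rw [e1, abs_mul, abs_of_nonneg (by positivity : (0 : ℝ) ≤ α / Nat.totient r)]
    have h1 : |L * (sig1 r k V - sig1 r k V') + (L - L') * sig1 r k V'| ≤
        1.2 * (Φ * (1 / U + 1 / U')) + |L - L'| * Φ := by
      have t1 : |L * (sig1 r k V - sig1 r k V')| ≤ 1.2 * (Φ * (1 / U + 1 / U')) := by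
        rw [abs_mul, abs_of_nonneg hlog0]
        exact mul_le_mul hlog3 (hS.trans hmin) (abs_nonneg _) (by norm_num)
      have t2 : |(L - L') * sig1 r k V'| ≤ |L - L'| * Φ := by
        rw [abs_mul, abs_of_nonneg (sig1_nonneg _ _ _)]
        exact mul_le_mul_of_nonneg_left ((sig1_le_totInvSum _ _ _).trans hΦV') (abs_nonneg _)
      exact (abs_add_le _ _).trans (by linarith)
    calc α / Nat.totient r * |L * (sig1 r k V - sig1 r k V') + (L - L') * sig1 r k V'|
        ≤ 1 / Nat.totient r * (1.2 * (Φ * (1 / U + 1 / U')) + |L - L'| * Φ) := by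
          refine mul_le_mul ?_ h1 (abs_nonneg _) (by positivity)
          exact div_le_div_of_nonneg_right hα1 hφr.le
      _ = Φ / Nat.totient r * (|L - L'| + 1.2 * (1 / U + 1 / U')) := by ring
  -- the error terms
  have hEb : 22 * (σ 0 k : ℝ) * totInvSum V / ((Nat.totient r : ℝ) * U) ≤
      Φ / Nat.totient r * (22 * (σ 0 k : ℝ) * (1 / U)) := by
    rw [div_mul_eq_mul_div, div_le_div_iff₀ (by positivity) hφr]
    have : 22 * (σ 0 k : ℝ) * totInvSum V * Nat.totient r ≤ 22 * (σ 0 k : ℝ) * Φ * Nat.totient r := by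
      gcongr
    calc 22 * (σ 0 k : ℝ) * totInvSum V * Nat.totient r ≤ 22 * (σ 0 k : ℝ) * Φ * Nat.totient r := this
      _ = Φ * (22 * (σ 0 k : ℝ) * (1 / U)) * ((Nat.totient r : ℝ) * U) := by field_simp
  have hEb' : 22 * (σ 0 k : ℝ) * totInvSum V' / ((Nat.totient r : ℝ) * U') ≤
      Φ / Nat.totient r * (22 * (σ 0 k : ℝ) * (1 / U')) := by
    rw [div_mul_eq_mul_div, div_le_div_iff₀ (by positivity) hφr]
    have : 22 * (σ 0 k : ℝ) * totInvSum V' * Nat.totient r ≤ 22 * (σ 0 k : ℝ) * Φ * Nat.totient r := by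
      gcongr
    calc 22 * (σ 0 k : ℝ) * totInvSum V' * Nat.totient r ≤ 22 * (σ 0 k : ℝ) * Φ * Nat.totient r := this
      _ = Φ * (22 * (σ 0 k : ℝ) * (1 / U')) * ((Nat.totient r : ℝ) * U') := by field_simp
  -- assemble
  have hE'' : |α * L' * sig1 r k V' / Nat.totient r - phiWin r k U' V'| ≤
      Φ / Nat.totient r * (22 * (σ 0 k : ℝ) * (1 / U')) := by
    rw [abs_sub_comm]; exact hE'.trans hEb'
  have hE1 : |phiWin r k U V - α * L * sig1 r k V / Nat.totient r| ≤
      Φ / Nat.totient r * (22 * (σ 0 k : ℝ) * (1 / U)) := hE.trans hEb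
  have t1 := abs_sub_le (phiWin r k U V) (α * L * sig1 r k V / Nat.totient r) (phiWin r k U' V')
  have t2 := abs_sub_le (α * L * sig1 r k V / Nat.totient r) (α * L' * sig1 r k V' / Nat.totient r)
    (phiWin r k U' V')
  have hc0 : 0 ≤ Φ / Nat.totient r := by positivity
  have hX0 : (0 : ℝ) ≤ 1 / U := by positivity
  have hX0' : (0 : ℝ) ≤ 1 / U' := by positivity
  have key : Φ / Nat.totient r * (22 * (σ 0 k : ℝ) * (1 / U)) +
      Φ / Nat.totient r * (|L - L'| + 1.2 * (1 / U + 1 / U')) +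
      Φ / Nat.totient r * (22 * (σ 0 k : ℝ) * (1 / U')) ≤
      Φ / Nat.totient r * (|L - L'| + 24 * (σ 0 k : ℝ) * (1 / U + 1 / U')) := by
    rw [← mul_add, ← mul_add]
    refine mul_le_mul_of_nonneg_left ?_ hc0
    nlinarith [mul_nonneg (sub_nonneg.2 hτ1) hX0, mul_nonneg (sub_nonneg.2 hτ1) hX0', abs_nonneg (L - L')]
  linarith [t1, t2, hE1, hM, hE'']

end BFI

end Literature.NumberTheory.Sieve
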